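import Mathlib.RingTheory.PowerSeries.WeierstrassPreparation
import Mathlib.RingTheory.PowerSeries.Substitution
import Mathlib.RingTheory.EuclideanDomain
import Mathlib.RingTheory.Polynomial.Content
import Literature.NumberTheory.EllipticCurves.PAdicPowerSeriesZeros
import HarnessLib

/-!
# The `p`-power map `T ↦ (1+T)^p - 1` on `Λ = ℤ_p⟦T⟧` and on `R⟦T⟧` — elementary algebra for the
# TUPLE RIGIDITY of the E-normalised tame branch (cell `b2b-bsdres`, sub-cell additive-p2, gen 21)

HONEST FRAMING (cell `b2b-bsdres`, run/shared/lean/b2b/bsd-rank1-residual/, verbatim in every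
file): the goal of the cell is to DELETE the COMBINATION-SHAPED residual classes of the
Birch–Swinnerton-Dyer formula for ALL analytic-rank `≤ 1` elliptic curves over `ℚ` — "full BSD
formula for every rank `≤ 1` curve in class `C`" assembled STRICTLY from published theorems — so
that the rank-`≤ 1` remainder becomes exactly the CONSTRUCTION-SHAPED classes, which are TYPED
(missing-input `Prop`s), NOT attempted. This is not "finishing BSD". Research route on the
CONSTRUCTION-SHAPED classes X3♯(G-ord)/X4♯(G-ord) (sub-cell additive-p2, gen 21); THEOREMS ONLY —
no definition, no named fact, no conjecture node; labels / RESIDUAL-MAP marks UNCHANGED; nothing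
booked.

The endomorphism of `Λ = ℤ_p⟦T⟧ ≅ ℤ_p⟦Γ⟧` induced by `γ ↦ γ^p` is, in `T = γ - 1`, the
substitution `G(T) ↦ G((1+T)^p - 1)` (Washington GTM 83 §7.2, §13.2); a character `κ` of `Γ` of
conductor `p^{m+1}` and its `p`-th power (conductor `p^m`) evaluate `G((1+T)^p-1)` resp. `G` at the
SAME point `κ(γ) - 1`. This file is the elementary algebra of this substitution (Mathlib
`PowerSeries.subst`), the toolkit of `PowerMapRigidity.lean` / `TameBranchRigidity.lean` (TUPLE
RIGIDITY of `IsTameBranchOf` — what `TameBranchUnique.lean` names as NOT proved: dependence on the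
unit `α` and on `ε` vs `ε̄`; A227 flag `Del02-ThmC-tuple-robustness`).
* §1 (any `R`, any `N`): `(1+T)^N - 1 = T·∑_{j<N}(1+T)^j`; the LOWEST coefficient is multiplied by
  `N^n` (`coeff_subst_one_add_X_pow_sub_one_of_forall_lt`); constants and units are preserved; over a
  characteristic-zero domain the map is injective and **`V(0) ≠ 0`, `V = u·V((1+T)^N-1)`, `N ≥ 2`
  force `u = 1` and `V` constant** (`eq_C_of_eq_C_mul_subst_one_add_X_pow_sub_one`).
* §2 (any field): **polynomial rigidity** — monic `P, P'`, `deg Φ ≥ 2`, `P'·(P∘Φ) = P·(P'∘Φ)`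
  force `P = P'` (`eq_of_mul_comp_eq_mul_comp`: divide by the gcd; a coprime pair has `P ∣ P∘Φ`
  with unit cofactor, so `deg P·deg Φ = deg P`); distinguished ∘ distinguished is distinguished
  (`isDistinguishedAt_comp`).
* §3 (`Λ`): `(1+X)^p - 1 ∈ ℤ_p[X]` is distinguished of degree `p`; on polynomials the substitution
  is composition (`subst_coe_eq_coe_comp`); mod `p` it is `T ↦ T^p`, so it does not kill reductions
  (`map_residue_subst_ne_zero`).
No definitions, no named facts; Mathlib's Weierstrass preparation and substitution APIs are reused.

## References

* L. C. Washington, *Introduction to cyclotomic fields*, GTM 83, §7.1–7.2, §13.2. [Washington1997]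
* S. Lang, *Cyclotomic fields I and II*, GTM 121, Ch. 5 §2. [Lang1990]
-/

noncomputable section

namespace Summit.BirchSwinnertonDyer.Rank1Residual.Additive

open Literature.NumberTheory.EllipticCurves

/-! ### §1 The power map `T ↦ (1+T)^N - 1` on `R⟦T⟧` -/

section PowerMap

open _root_.PowerSeries

variable {R : Type*} [CommRing R] (N : ℕ)

/-- `(1+T)^N - 1` has no constant term. [folklore] -/
theorem constantCoeff_one_add_X_pow_sub_one :
    constantCoeff ((1 + X : R⟦X⟧) ^ N - 1) = 0 := by
  simp

/-- `(1+T)^N - 1` may be substituted into power series. [folklore] -/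
theorem hasSubst_one_add_X_pow_sub_one : HasSubst ((1 + X : R⟦X⟧) ^ N - 1) :=
  HasSubst.of_constantCoeff_zero' (constantCoeff_one_add_X_pow_sub_one N)

/-- `(1+T)^N - 1 = T · ∑_{j<N} (1+T)^j`. [folklore] -/
theorem one_add_X_pow_sub_one_eq_X_mul :
    ((1 + X : R⟦X⟧) ^ N - 1) = X * ∑ j ∈ Finset.range N, (1 + X : R⟦X⟧) ^ j := by
  have h := geom_sum_mul (1 + X : R⟦X⟧) N
  rw [add_sub_cancel_left] at h
  rw [← h, mul_comm]

/-- The constant term of `∑_{j<N} (1+T)^j` is `N`. [folklore] -/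
theorem constantCoeff_sum_one_add_X_pow :
    constantCoeff (∑ j ∈ Finset.range N, (1 + X : R⟦X⟧) ^ j) = N := by
  rw [map_sum]
  simp

/-- `T^d ∣ ((1+T)^N - 1)^d`, so the coefficients of `((1+T)^N - 1)^d` below degree `d` vanish.
[folklore] -/
theorem coeff_one_add_X_pow_sub_one_pow_eq_zero {d n : ℕ} (h : n < d) :
    coeff n (((1 + X : R⟦X⟧) ^ N - 1) ^ d) = 0 := by
  have hdvd : (X : R⟦X⟧) ^ d ∣ ((1 + X : R⟦X⟧) ^ N - 1) ^ d := by
    rw [one_add_X_pow_sub_one_eq_X_mul, mul_pow]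
    exact dvd_mul_right _ _
  exact (X_pow_dvd_iff.mp hdvd) n h

/-- The degree-`d` coefficient of `((1+T)^N - 1)^d` is `N^d`. [folklore] -/
theorem coeff_one_add_X_pow_sub_one_pow_self (d : ℕ) :
    coeff d (((1 + X : R⟦X⟧) ^ N - 1) ^ d) = (N : R) ^ d := by
  rw [one_add_X_pow_sub_one_eq_X_mul, mul_pow, coeff_X_pow_mul', if_pos le_rfl, Nat.sub_self,
    coeff_zero_eq_constantCoeff, map_pow, constantCoeff_sum_one_add_X_pow]

/-- **Lowest coefficient under the power map.** If the coefficients of `G` below degree `n` vanish,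
then the degree-`n` coefficient of `G((1+T)^N - 1)` is `N^n · [T^n]G`. [folklore] -/
theorem coeff_subst_one_add_X_pow_sub_one_of_forall_lt {G : R⟦X⟧} {n : ℕ}
    (hG : ∀ k < n, coeff k G = 0) :
    coeff n (G.subst ((1 + X : R⟦X⟧) ^ N - 1)) = (N : R) ^ n * coeff n G := by
  rw [coeff_subst' (hasSubst_one_add_X_pow_sub_one N), finsum_eq_single _ n]
  · rw [coeff_one_add_X_pow_sub_one_pow_self, smul_eq_mul, mul_comm]
  · intro d hd
    rcases lt_or_gt_of_ne hd with hlt | hgt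
    · rw [hG d hlt, zero_smul]
    · rw [coeff_one_add_X_pow_sub_one_pow_eq_zero N hgt, smul_zero]

/-- The power map preserves constant terms: `G((1+T)^N - 1)(0) = G(0)`. [folklore] -/
theorem constantCoeff_subst_one_add_X_pow_sub_one (G : R⟦X⟧) :
    constantCoeff (G.subst ((1 + X : R⟦X⟧) ^ N - 1)) = constantCoeff G := by
  rw [← coeff_zero_eq_constantCoeff_apply, ← coeff_zero_eq_constantCoeff_apply,
    coeff_subst_one_add_X_pow_sub_one_of_forall_lt N (fun k hk ↦ absurd hk (Nat.not_lt_zero k)),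
    pow_zero, one_mul]

/-- The power map preserves units. [folklore] -/
theorem isUnit_subst_one_add_X_pow_sub_one {U : R⟦X⟧} (hU : IsUnit U) :
    IsUnit (U.subst ((1 + X : R⟦X⟧) ^ N - 1)) := by
  rw [isUnit_iff_constantCoeff, constantCoeff_subst_one_add_X_pow_sub_one]
  exact isUnit_iff_constantCoeff.mp hU

/-- **The power map `G ↦ G((1+T)^N - 1)` is injective** over a domain of characteristic zero
(`N ≠ 0`): the lowest non-zero coefficient `[T^n]G` becomes `N^n [T^n]G ≠ 0`. [folklore] -/
theorem eq_zero_of_subst_one_add_X_pow_sub_one_eq_zero [IsDomain R] [CharZero R] (hN : N ≠ 0)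
    {G : R⟦X⟧} (h : G.subst ((1 + X : R⟦X⟧) ^ N - 1) = 0) : G = 0 := by
  by_contra hG
  have hex : ∃ n, coeff n G ≠ 0 := by
    by_contra hall
    push Not at hall
    exact hG (PowerSeries.ext fun n ↦ by rw [hall n, map_zero])
  classical
  let n := Nat.find hex
  have hn : coeff n G ≠ 0 := Nat.find_spec hex
  have hlt : ∀ k < n, coeff k G = 0 := fun k hk ↦ by
    have := Nat.find_min hex hk
    push Not at this
    exact this
  have hc := coeff_subst_one_add_X_pow_sub_one_of_forall_lt N hlt
  rw [h, map_zero] at hc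
  have hNn : ((N : R)) ^ n ≠ 0 := pow_ne_zero _ (Nat.cast_ne_zero.mpr hN)
  exact hn ((mul_eq_zero.mp hc.symm).resolve_left hNn)

/-- **Rigidity of units under the power map.** Over a domain of characteristic zero, `N ≥ 2`: if
`V = u · V((1+T)^N - 1)` and `V(0) ≠ 0`, then `u = 1` and `V` is CONSTANT (compare the lowest
non-constant coefficient: `[T^n]V = N^n [T^n]V` forces `[T^n]V = 0`). [folklore] -/
theorem eq_C_of_eq_C_mul_subst_one_add_X_pow_sub_one [IsDomain R] [CharZero R] (hN : 2 ≤ N)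
    {V : R⟦X⟧} {u : R} (hV0 : constantCoeff V ≠ 0)
    (h : V = C u * V.subst ((1 + X : R⟦X⟧) ^ N - 1)) :
    u = 1 ∧ V = C (constantCoeff V) := by
  -- constant terms: `V(0) = u V(0)`
  have hu : u = 1 := by
    have h0 := congr_arg constantCoeff h
    rw [map_mul, constantCoeff_C, constantCoeff_subst_one_add_X_pow_sub_one] at h0
    conv_lhs at h0 => rw [← one_mul (constantCoeff V)]
    exact (mul_right_cancel₀ hV0 h0).symm
  refine ⟨hu, ?_⟩
  rw [hu, map_one, one_mul] at h
  -- `W = V - V(0)` satisfies `W = W((1+T)^N - 1)` and `W(0) = 0`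
  set W : R⟦X⟧ := V - C (constantCoeff V) with hW
  have hWs : W = W.subst ((1 + X : R⟦X⟧) ^ N - 1) := by
    rw [hW, subst_sub (hasSubst_one_add_X_pow_sub_one N), subst_C, ← h]
    rfl
  suffices hW0 : W = 0 by rwa [hW, sub_eq_zero] at hW0
  by_contra hW0
  have hex : ∃ n, coeff n W ≠ 0 := by
    by_contra hall
    push Not at hall
    exact hW0 (PowerSeries.ext fun n ↦ by rw [hall n, map_zero])
  classical
  let n := Nat.find hex
  have hn : coeff n W ≠ 0 := Nat.find_spec hex
  have hlt : ∀ k < n, coeff k W = 0 := fun k hk ↦ by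
    have := Nat.find_min hex hk
    push Not at this
    exact this
  have hn0 : n ≠ 0 := by
    intro hn0
    apply hn
    rw [hn0, coeff_zero_eq_constantCoeff_apply, hW, map_sub, constantCoeff_C, sub_self]
  have hc := coeff_subst_one_add_X_pow_sub_one_of_forall_lt N hlt (G := W)
  rw [← hWs] at hc
  -- `[T^n]W = N^n [T^n]W` with `N^n ≠ 1`
  have hNn : ((N : R)) ^ n ≠ 1 := by
    rw [← Nat.cast_pow, show (1 : R) = ((1 : ℕ) : R) by rw [Nat.cast_one], Ne,
      Nat.cast_inj]
    exact (Nat.one_lt_pow hn0 (by omega)).ne'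
  apply hn
  have h1 : ((N : R) ^ n - 1) * coeff n W = 0 := by rw [sub_mul, one_mul, ← hc, sub_self]
  exact (mul_eq_zero.mp h1).resolve_left (sub_ne_zero.mpr hNn)

end PowerMap

/-! ### §2 Polynomial rigidity under composition -/

section PolyRigid

open _root_.Polynomial

variable {K : Type*} [Field K]

/-- Auxiliary: over a field, if `P` and `P'` are COPRIME monic polynomials with
`P'·(P∘Φ) = P·(P'∘Φ)` for a polynomial `Φ` of degree `≥ 2`, then `P = 1` (`P ∣ P∘Φ` with a
cofactor dividing the coprime pair `P∘Φ`, `P'∘Φ`, hence a unit; degrees force `deg P = 0`).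
[folklore] -/
theorem eq_one_of_isCoprime_of_mul_comp_eq {P P' Φ : K[X]} (hP : P.Monic) (hP' : P'.Monic)
    (hΦ : 2 ≤ Φ.natDegree) (hcop : IsCoprime P P')
    (h : P' * P.comp Φ = P * P'.comp Φ) : P = 1 := by
  -- `P ∣ P ∘ Φ` and `P' ∣ P' ∘ Φ`
  have hdvd : P ∣ P.comp Φ := hcop.dvd_of_dvd_mul_left ⟨P'.comp Φ, by rw [h]⟩
  have hdvd' : P' ∣ P'.comp Φ :=
    hcop.symm.dvd_of_dvd_mul_left ⟨P.comp Φ, by rw [mul_comm, h, mul_comm]⟩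
  obtain ⟨Q, hQ⟩ := hdvd
  obtain ⟨Q', hQ'⟩ := hdvd'
  have hP0 : P ≠ 0 := hP.ne_zero
  have hP'0 : P' ≠ 0 := hP'.ne_zero
  -- the cofactors agree
  have hQQ' : Q = Q' := by
    have h1 : P * P' * Q = P * P' * Q' := by
      calc P * P' * Q = P' * P.comp Φ := by rw [hQ]; ring
        _ = P * P'.comp Φ := h
        _ = P * P' * Q' := by rw [hQ']; ring
    exact mul_left_cancel₀ (mul_ne_zero hP0 hP'0) h1
  -- `P ∘ Φ` and `P' ∘ Φ` are coprime, so `Q` is a unit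
  have hcop' : IsCoprime (P.comp Φ) (P'.comp Φ) := by
    obtain ⟨a, b, hab⟩ := hcop
    refine ⟨a.comp Φ, b.comp Φ, ?_⟩
    rw [← mul_comp, ← mul_comp, ← add_comp, hab, one_comp]
  have hQunit : IsUnit Q :=
    hcop'.isUnit_of_dvd' ⟨P, by rw [hQ, mul_comm]⟩ ⟨P', by rw [hQ', hQQ', mul_comm]⟩
  -- degrees: `deg P · deg Φ = deg P + 0`
  have hdeg : P.natDegree * Φ.natDegree = P.natDegree := by
    have hQ0 : Q ≠ 0 := hQunit.ne_zero
    rw [← natDegree_comp, hQ, natDegree_mul hP0 hQ0, natDegree_eq_zero_of_isUnit hQunit,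
      add_zero]
  have hP1 : P.natDegree = 0 := by
    by_contra hne
    have : P.natDegree * 2 ≤ P.natDegree * Φ.natDegree := Nat.mul_le_mul_left _ hΦ
    omega
  exact eq_one_of_monic_natDegree_zero hP hP1

/-- **Polynomial rigidity under composition.** Over a field, for MONIC `P`, `P'` and `Φ` of degree
`≥ 2`: `P'·(P∘Φ) = P·(P'∘Φ)` implies `P = P'` (divide by the monic gcd and apply
`eq_one_of_isCoprime_of_mul_comp_eq` to both cofactors). [folklore] -/
theorem eq_of_mul_comp_eq_mul_comp {P P' Φ : K[X]} (hP : P.Monic) (hP' : P'.Monic)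
    (hΦ : 2 ≤ Φ.natDegree) (h : P' * P.comp Φ = P * P'.comp Φ) : P = P' := by
  classical
  have hP0 : P ≠ 0 := hP.ne_zero
  set G := GCDMonoid.gcd P P' with hG
  have hG0 : G ≠ 0 := gcd_ne_zero_of_left hP0
  obtain ⟨P₁, hP₁⟩ := GCDMonoid.gcd_dvd_left P P'
  obtain ⟨P₁', hP₁'⟩ := GCDMonoid.gcd_dvd_right P P'
  rw [← hG] at hP₁ hP₁'
  -- `G` is monic (normalized gcd of a monic polynomial), hence so are the cofactors
  have hGmonic : G.Monic := by
    have hnorm : normalize G = G := normalize_gcd P P'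
    rw [← hnorm]
    exact Polynomial.monic_normalize hG0
  have hP₁m : P₁.Monic := hGmonic.of_mul_monic_left (hP₁ ▸ hP)
  have hP₁'m : P₁'.Monic := hGmonic.of_mul_monic_left (hP₁' ▸ hP')
  -- the cofactors are coprime
  have hcop : IsCoprime P₁ P₁' := by
    have hc := isCoprime_div_gcd_div_gcd (p := P) hP'.ne_zero
    rw [← hG] at hc
    have h1 : P / G = P₁ := by rw [hP₁, mul_div_cancel_left₀ _ hG0]
    have h2 : P' / G = P₁' := by rw [hP₁', mul_div_cancel_left₀ _ hG0]
    rwa [h1, h2] at hc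
  -- `G ∘ Φ ≠ 0`
  have hGΦ : G.comp Φ ≠ 0 := by
    rw [Ne, comp_eq_zero_iff, not_or]
    refine ⟨hG0, fun hh ↦ ?_⟩
    have hd := congr_arg natDegree hh.2
    rw [natDegree_C] at hd
    omega
  -- cancel `G · (G ∘ Φ)` from the relation
  have hrel : P₁' * P₁.comp Φ = P₁ * P₁'.comp Φ := by
    have h1 : G * G.comp Φ * (P₁' * P₁.comp Φ) = G * G.comp Φ * (P₁ * P₁'.comp Φ) := by
      calc G * G.comp Φ * (P₁' * P₁.comp Φ) = (G * P₁') * (G * P₁).comp Φ := by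
            rw [mul_comp]; ring
        _ = P' * P.comp Φ := by rw [← hP₁, ← hP₁']
        _ = P * P'.comp Φ := h
        _ = (G * P₁) * (G * P₁').comp Φ := by rw [← hP₁, ← hP₁']
        _ = G * G.comp Φ * (P₁ * P₁'.comp Φ) := by rw [mul_comp]; ring
    exact mul_left_cancel₀ (mul_ne_zero hG0 hGΦ) h1
  have h₁ : P₁ = 1 := eq_one_of_isCoprime_of_mul_comp_eq hP₁m hP₁'m hΦ hcop hrel
  have h₁' : P₁' = 1 := eq_one_of_isCoprime_of_mul_comp_eq hP₁'m hP₁m hΦ hcop.symm hrel.symm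
  rw [hP₁, hP₁', h₁, h₁']

/-- **A distinguished polynomial composed with a non-constant distinguished polynomial is
distinguished**: it is monic, and modulo `I` it is `(X^e)^d = X^{de}`. [folklore] -/
theorem isDistinguishedAt_comp {A : Type*} [CommRing A] [NoZeroDivisors A] [Nontrivial A]
    {I : Ideal A} {P Q : A[X]}
    (hP : P.IsDistinguishedAt I) (hQ : Q.IsDistinguishedAt I) (hQ0 : Q.natDegree ≠ 0) :
    (P.comp Q).IsDistinguishedAt I where
  monic := hP.monic.comp hQ.monic hQ0
  mem {n} hn := by
    rw [natDegree_comp] at hn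
    rw [← Ideal.Quotient.eq_zero_iff_mem, ← Polynomial.coeff_map, Polynomial.map_comp,
      hP.map_eq_X_pow, hQ.map_eq_X_pow, X_pow_comp, ← pow_mul, coeff_X_pow, if_neg]
    rw [mul_comm]
    exact hn.ne

end PolyRigid

/-! ### §3 The `p`-power map on `Λ = ℤ_p⟦T⟧` -/

section IntegralPowerMap

open _root_.PowerSeries

variable {p : ℕ} [hp : Fact p.Prime]

/-- **`(1+X)^p - 1 ∈ ℤ_p[X]` is a distinguished polynomial of degree `p`**: monic, constant term
`0`, middle coefficients `binom(p,i) ∈ pℤ_p`. [folklore] -/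
theorem isDistinguishedAt_one_add_X_pow_prime_sub_one :
    ((1 + Polynomial.X : Polynomial ℤ_[p]) ^ p - 1).IsDistinguishedAt
      (IsLocalRing.maximalIdeal ℤ_[p]) ∧
    ((1 + Polynomial.X : Polynomial ℤ_[p]) ^ p - 1).natDegree = p := by
  have hp1 : p ≠ 0 := hp.out.ne_zero
  have hmonic1 : ((1 + Polynomial.X : Polynomial ℤ_[p]) ^ p).Monic := by
    rw [add_comm]
    exact (Polynomial.monic_X_add_C 1).pow p
  have hdeg1 : ((1 + Polynomial.X : Polynomial ℤ_[p]) ^ p).natDegree = p := by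
    rw [add_comm, ← Polynomial.C_1, Polynomial.natDegree_pow, Polynomial.natDegree_X_add_C,
      mul_one]
  have hlt : (1 : Polynomial ℤ_[p]).degree < ((1 + Polynomial.X : Polynomial ℤ_[p]) ^ p).degree := by
    rw [Polynomial.degree_one, Polynomial.degree_eq_natDegree hmonic1.ne_zero, hdeg1]
    exact_mod_cast hp.out.pos
  have hmonic : ((1 + Polynomial.X : Polynomial ℤ_[p]) ^ p - 1).Monic := hmonic1.sub_of_left hlt
  have hdeg : ((1 + Polynomial.X : Polynomial ℤ_[p]) ^ p - 1).natDegree = p := by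
    rw [Polynomial.natDegree_eq_of_degree_eq (Polynomial.degree_sub_eq_left_of_degree_lt hlt),
      hdeg1]
  refine ⟨⟨⟨fun {n} hn ↦ ?_⟩, hmonic⟩, hdeg⟩
  rw [hdeg] at hn
  rw [Polynomial.coeff_sub, Polynomial.coeff_one_add_X_pow, Polynomial.coeff_one]
  rcases Nat.eq_zero_or_pos n with rfl | hn0
  · simp
  · rw [if_neg hn0.ne', sub_zero, PadicInt.maximalIdeal_eq_span_p, Ideal.mem_span_singleton]
    exact Nat.cast_dvd_cast (hp.out.dvd_choose_self hn0.ne' hn)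

/-- The power series `(1+T)^p - 1 ∈ Λ` is the image of the polynomial `(1+X)^p - 1`. [folklore] -/
theorem coe_one_add_X_pow_sub_one (R : Type*) [CommRing R] (N : ℕ) :
    (((1 + Polynomial.X : Polynomial R) ^ N - 1 : Polynomial R) : PowerSeries R) =
      (1 + X : PowerSeries R) ^ N - 1 := by
  rw [Polynomial.coe_sub, Polynomial.coe_pow, Polynomial.coe_add, Polynomial.coe_one,
    Polynomial.coe_X]

/-- Substituting the power map into (the image of) a polynomial is composition with
`(1+X)^N - 1`. [folklore] -/
theorem subst_coe_eq_coe_comp (R : Type*) [CommRing R] (N : ℕ) (P : Polynomial R) :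
    (P : PowerSeries R).subst ((1 + X : PowerSeries R) ^ N - 1) =
      ((P.comp ((1 + Polynomial.X : Polynomial R) ^ N - 1) : Polynomial R) : PowerSeries R) := by
  rw [subst_coe (hasSubst_one_add_X_pow_sub_one N), ← coe_one_add_X_pow_sub_one,
    Polynomial.comp_eq_aeval]
  have h := Polynomial.aeval_algHom_apply (Polynomial.coeToPowerSeries.algHom R)
    ((1 + Polynomial.X : Polynomial R) ^ N - 1) P
  simp only [Polynomial.coeToPowerSeries.algHom_apply] at h
  exact h

/-- Reduction mod `p` of the power map: `(1+T)^p - 1 ≡ T^p`. [folklore] -/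
theorem map_residue_one_add_X_pow_prime_sub_one :
    PowerSeries.map (IsLocalRing.residue ℤ_[p]) ((1 + X : PowerSeries ℤ_[p]) ^ p - 1) = X ^ p := by
  obtain ⟨hdist, hdeg⟩ := isDistinguishedAt_one_add_X_pow_prime_sub_one (p := p)
  have h := hdist.map_eq_X_pow
  rw [hdeg] at h
  have h' : Polynomial.map (IsLocalRing.residue ℤ_[p])
      ((1 + Polynomial.X : Polynomial ℤ_[p]) ^ p - 1) = Polynomial.X ^ p := h
  rw [← coe_one_add_X_pow_sub_one, ← Polynomial.polynomial_map_coe, h', Polynomial.coe_pow,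
    Polynomial.coe_X]

/-- **The power map does not kill reductions mod `p`**: if `G mod p ≠ 0` then
`G((1+T)^p - 1) mod p = Ḡ(T^p) ≠ 0`. [folklore] -/
theorem map_residue_subst_ne_zero {G : PowerSeries ℤ_[p]}
    (hG : PowerSeries.map (IsLocalRing.residue ℤ_[p]) G ≠ 0) :
    PowerSeries.map (IsLocalRing.residue ℤ_[p]) (G.subst ((1 + X : PowerSeries ℤ_[p]) ^ p - 1)) ≠ 0 := by
  have hp0 : p ≠ 0 := hp.out.ne_zero
  have hms : PowerSeries.map (IsLocalRing.residue ℤ_[p])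
      (G.subst ((1 + X : PowerSeries ℤ_[p]) ^ p - 1)) =
      (PowerSeries.map (IsLocalRing.residue ℤ_[p]) G).subst
        (PowerSeries.map (IsLocalRing.residue ℤ_[p]) ((1 + X : PowerSeries ℤ_[p]) ^ p - 1)) :=
    PowerSeries.map_subst (hasSubst_one_add_X_pow_sub_one p) G
  rw [hms, map_residue_one_add_X_pow_prime_sub_one]
  obtain ⟨n, hn⟩ : ∃ n, coeff n (PowerSeries.map (IsLocalRing.residue ℤ_[p]) G) ≠ 0 := by
    by_contra hall
    push Not at hall
    exact hG (PowerSeries.ext fun n ↦ by rw [hall n, map_zero])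
  intro h0
  have hc := congr_arg (coeff (p * n)) h0
  rw [coeff_subst_X_pow hp0, if_pos (dvd_mul_right p n), Nat.mul_div_cancel_left n hp.out.pos,
    map_zero, Algebra.algebraMap_self, RingHom.id_apply] at hc
  exact hn hc

end IntegralPowerMap

end Summit.BirchSwinnertonDyer.Rank1Residual.Additive

end
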